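import Summits.Langlands.Langlands.Theses.NonParallelVoid
import Summits.Langlands.Langlands.Theorems.IrreducibilityBySelfDualityReciprocityUpToIrreducibilityCorrespondsConj
import HarnessLib

/-!
# `VoidToLanglands` (crux stmt-Langlands-17006, route `NonParallelVoid`), negative side:
# refutability criterion, and TIGHTNESS of the picked line `satake_sector_cut` — every open stub is a
# consequence of the summit as typed (refuter cdisprove seat, cycle 1)

`VoidToLanglands := Target → Langlands` is the route's declared remainder (`Target` = non-parallel
regular weights are void for `GL₂` over imaginary quadratic fields; `Langlands` = the `∀ 𝓡` summit).
This file records, sorry-free and without defining any proposition under `Summits/`: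

* `not_voidToLanglands_iff` — **refutability criterion**: `¬ VoidToLanglands ↔ Target ∧ ¬ Langlands`.
  A kill of the crux needs a PROOF of Calegari–Mazur's parallel-weight statement (open; it is the
  conjunction of the route's five cruxes) AND a DISPROOF of `GL_n` reciprocity as typed (none);
  `not_langlands_of_not_voidToLanglands` — in particular every refutation of the crux refutes the summit.
* **Tightness of line `satake_sector_cut`** (registered skeleton, six open stubs after U landed,
  p165550): each open stub, stated INLINE verbatim, follows from `Langlands`, with the contrapositive
  `¬ stub → ¬ Langlands` recorded next to it —
  `stub_satakeAvatarExistence_of_langlands` (W⁺ = stmt-Langlands-17415: direction (A), Satake clause),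
  `stub_padicMemberCompatibility_of_langlands` (P = stmt-Langlands-17534) and
  `stub_compatibilityAwayFromLAll_of_langlands` (L∤∀ = the `∀ Rec` text of stmt-Langlands-17417) —
  both through the landed change-of-frame package of `ReciprocityUpToIrreducibility`: an irreducible
  Satake avatar of `(π, ι)` is conjugate to the summit's `ρ_{π,ι}` (Chebotarev + Brauer–Nesbitt,
  `isConjugate_of_satakeFrobCompatibleAt`) and `IsGeometricFramed`, `Corresponds` descend to conjugacy
  classes (`isGeometricFramed_of_isConjugate`, `corresponds_of_exists_corresponds`) —,
  `stub_weakAutomorphyOffSector_of_langlands` (B_w⁻) and `stub_weakParallelModularity_of_langlands`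
  (B_w⁺, the `Target`-fed stub): direction (B), sector data discarded.  The sixth open stub RD
  (`stub_canonicalReciprocityData` = stmt-Langlands-17930, the summit's non-vacuity conjunct) is
  summit-implied by the already LANDED `ramifiedCoefficientSeed_stubReciprocityData_of_langlands`
  (`Theorems/SectorComplement/Negative/RamifiedCoefficientSeedSectorComplementStubsSummitImplied.lean`,
  same text) and is not restated here.

Moral for the lead and for triage: NO stub of the line is refutable short of `¬ Langlands` (a
`stub_*_false` theorem would disprove the summit), none is junk-false (`0 < n` / `n = 2` throughout),
and with the landed glue `NonParallelVoidSatakeSectorCut.nonParallelVoid_voidToLanglands_of_leaves` the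
stub set is exactly summit-strength: `Langlands → stubs → VoidToLanglands`, and `stubs ↔ Langlands`
given `Target`.  The disprover has no object to attack on this line.  This file does NOT refute the
crux.  Work file: `Cruxes/VoidToLanglands/Disproof.lean`.

References: [BuzzardGeeLMS2014] Conj. 3.2.1–3.2.2; [FontaineMazurGeometric1995] Conj. 1;
[DeligneSerreASENS1974] Lemme 3.2; [CalegariMazur2008] Conj. 1.3.
-/

noncomputable section

set_option linter.dupNamespace false -- project-wide option; `Summit.Langlands.Langlands` is the mandated namespace

namespace Summit.Langlands.Langlands.Theorems.VoidToLanglands.Negative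

open scoped BigOperators Topology Classical Matrix NumberField
open Filter IsDedekindDomain
open Summit.Langlands
open Summit.Langlands.Langlands.Theorems (ReciprocityUpToIrreducibility.isConjugate_of_satakeFrobCompatibleAt
  ReciprocityUpToIrreducibility.isGeometricFramed_of_isConjugate
  ReciprocityUpToIrreducibility.corresponds_of_exists_corresponds)
open Summit.Langlands.Langlands.Theses.NonParallelVoid (Target VoidToLanglands)

/-! ## 1. Refutability criterion -/

/-- **`VoidToLanglands` is false iff `Target` holds and the summit fails** (the crux is
`Target → Langlands` definitionally). [folklore] -/
theorem not_voidToLanglands_iff : ¬ VoidToLanglands ↔ (Target ∧ ¬ _root_.Langlands) :=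
  show ¬ (Target → _root_.Langlands) ↔ _ from Classical.not_imp

/-- Every refutation of the crux is a refutation of the summit as typed. [folklore] -/
theorem not_langlands_of_not_voidToLanglands (h : ¬ VoidToLanglands) : ¬ _root_.Langlands :=
  (not_voidToLanglands_iff.1 h).2

/-! ## 2. Tightness of line `satake_sector_cut`: the open stubs from the summit -/

/-- **Stub W⁺ (`stub_satakeAvatarExistence`, = stmt-Langlands-17415) from the summit**: direction (A)
for any datum, keeping irreducibility and the Satake clause of `Corresponds`.
[cite: BuzzardGeeLMS2014, Conj. 3.2.2] -/
theorem stub_satakeAvatarExistence_of_langlands (h : _root_.Langlands) :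
∀ (K : Type) [Field K] [NumberField K] (n : ℕ) (hcpt : Literature.NumberTheory.Automorphic.isCompact_glFiniteIntegralLevel n K), 0 < n → ∀ (π : Literature.NumberTheory.Automorphic.CuspidalAutomorphicRepData n K hcpt), π.1.IsLAlgebraic → ∀ (ℓ : ℕ) [Fact ℓ.Prime] (ι : PadicAlgCl ℓ ≃+* ℂ), ∃ ρ : Literature.NumberTheory.GaloisRepresentations.FramedGaloisRep K (PadicAlgCl ℓ) n, ρ.toGaloisRep.IsIrreducible ∧ ∀ᶠ v : IsDedekindDomain.HeightOneSpectrum (NumberField.RingOfIntegers K) in cofinite, SatakeFrobCompatibleAt ι π.1 ρ v := by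
  intro K _ _ n hcpt hn π hL ℓ _ ι
  obtain ⟨⟨Rec⟩, hR⟩ := h K
  obtain ⟨ρ, hirr, -, hcorr, -⟩ := (hR Rec n hn hcpt).1 π hL ℓ ι
  exact ⟨ρ, hirr, hcorr.1⟩

/-- … so a counterexample to W⁺ refutes the summit. [folklore] -/
theorem not_langlands_of_not_stub_satakeAvatarExistence (h : ¬ (
∀ (K : Type) [Field K] [NumberField K] (n : ℕ) (hcpt : Literature.NumberTheory.Automorphic.isCompact_glFiniteIntegralLevel n K), 0 < n → ∀ (π : Literature.NumberTheory.Automorphic.CuspidalAutomorphicRepData n K hcpt), π.1.IsLAlgebraic → ∀ (ℓ : ℕ) [Fact ℓ.Prime] (ι : PadicAlgCl ℓ ≃+* ℂ), ∃ ρ : Literature.NumberTheory.GaloisRepresentations.FramedGaloisRep K (PadicAlgCl ℓ) n, ρ.toGaloisRep.IsIrreducible ∧ ∀ᶠ v : IsDedekindDomain.HeightOneSpectrum (NumberField.RingOfIntegers K) in cofinite, SatakeFrobCompatibleAt ι π.1 ρ v)) : ¬ _root_.Langlands :=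
  fun hL => h (stub_satakeAvatarExistence_of_langlands hL)

/-- **Stub P (`stub_padicMemberCompatibility`, = stmt-Langlands-17534) from the summit.**  An
irreducible Satake avatar `ρ` of `(π, ι)` is conjugate to the `ρ_{π,ι}` of direction (A)
(`isConjugate_of_satakeFrobCompatibleAt`); geometricity descends to conjugacy classes
(`isGeometricFramed_of_isConjugate`), giving (i) de Rham above `ℓ` for the pinned datum, and
`Corresponds` descends (`corresponds_of_exists_corresponds`), giving (ii) local–global compatibility
at every place for every datum — the prime-switch hypotheses of (ii) are not even used.
[cite: DeligneSerreASENS1974, Lemme 3.2] -/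
theorem stub_padicMemberCompatibility_of_langlands (h : _root_.Langlands) :
∀ (K : Type) [Field K] [NumberField K] (n : ℕ) (hcpt : Literature.NumberTheory.Automorphic.isCompact_glFiniteIntegralLevel n K), 0 < n → ∀ (π : Literature.NumberTheory.Automorphic.CuspidalAutomorphicRepData n K hcpt), π.1.IsLAlgebraic → ∀ (ℓ : ℕ) [Fact ℓ.Prime] (ι : PadicAlgCl ℓ ≃+* ℂ) (ρ : Literature.NumberTheory.GaloisRepresentations.FramedGaloisRep K (PadicAlgCl ℓ) n), ρ.toGaloisRep.IsIrreducible → (∀ᶠ v : IsDedekindDomain.HeightOneSpectrum (NumberField.RingOfIntegers K) in cofinite, SatakeFrobCompatibleAt ι π.1 ρ v) → ∀ (v : IsDedekindDomain.HeightOneSpectrum (NumberField.RingOfIntegers K)) (hv : ((ℓ : ℕ) : NumberField.RingOfIntegers K) ∈ v.asIdeal), (Literature.NumberTheory.PAdicHodge.fontainePstAdicCompletion v ℓ hv).IsDeRhamFramed (ρ.toLocal v) ∧ ∀ (Rec : ReciprocityData K) (ℓ' : ℕ) [Fact ℓ'.Prime] (ι' : PadicAlgCl ℓ' ≃+* ℂ)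 (ρ' : Literature.NumberTheory.GaloisRepresentations.FramedGaloisRep K (PadicAlgCl ℓ') n), ((ℓ' : ℕ) : NumberField.RingOfIntegers K) ∉ v.asIdeal → ρ'.toGaloisRep.IsIrreducible → (∀ᶠ w : IsDedekindDomain.HeightOneSpectrum (NumberField.RingOfIntegers K) in cofinite, SatakeFrobCompatibleAt ι' π.1 ρ' w) → LocalGlobalCompatibleAt Rec ι' π.1 ρ' v → LocalGlobalCompatibleAt Rec ι π.1 ρ v := by
  intro K _ _ n hcpt hn π hL ℓ _ ι ρ hirr hρ v hv
  obtain ⟨⟨Rec₀⟩, hR⟩ := h K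
  refine ⟨?_, fun Rec ℓ' _ ι' ρ' _ _ _ _ => ?_⟩
  · obtain ⟨ρ₁, hirr₁, hgeo₁, hc₁, -⟩ := (hR Rec₀ n hn hcpt).1 π hL ℓ ι
    have hconj : IsConjugate ρ₁ ρ :=
      ReciprocityUpToIrreducibility.isConjugate_of_satakeFrobCompatibleAt π.1 ι hirr₁ hc₁.1 hρ
    exact (ReciprocityUpToIrreducibility.isGeometricFramed_of_isConjugate hgeo₁ hconj).2 v hv
  · obtain ⟨ρ₁, -, -, hc₁, -⟩ := (hR Rec n hn hcpt).1 π hL ℓ ι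
    exact (ReciprocityUpToIrreducibility.corresponds_of_exists_corresponds hirr hρ ⟨ρ₁, hc₁⟩).2 v

/-- … so a counterexample to P refutes the summit. [folklore] -/
theorem not_langlands_of_not_stub_padicMemberCompatibility (h : ¬ (
∀ (K : Type) [Field K] [NumberField K] (n : ℕ) (hcpt : Literature.NumberTheory.Automorphic.isCompact_glFiniteIntegralLevel n K), 0 < n → ∀ (π : Literature.NumberTheory.Automorphic.CuspidalAutomorphicRepData n K hcpt), π.1.IsLAlgebraic → ∀ (ℓ : ℕ) [Fact ℓ.Prime] (ι : PadicAlgCl ℓ ≃+* ℂ) (ρ : Literature.NumberTheory.GaloisRepresentations.FramedGaloisRep K (PadicAlgCl ℓ) n), ρ.toGaloisRep.IsIrreducible → (∀ᶠ v : IsDedekindDomain.HeightOneSpectrum (NumberField.RingOfIntegers K) in cofinite, SatakeFrobCompatibleAt ι π.1 ρ v) → ∀ (v : IsDedekindDomain.HeightOneSpectrum (NumberField.RingOfIntegers K)) (hv : ((ℓ : ℕ) : NumberField.RingOfIntegers K) ∈ v.asIdeal), (Literature.NumberTheory.PAdicHodge.fontainePstAdicCompletion v ℓ hv).IsDeRhamFramed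 (ρ.toLocal v) ∧ ∀ (Rec : ReciprocityData K) (ℓ' : ℕ) [Fact ℓ'.Prime] (ι' : PadicAlgCl ℓ' ≃+* ℂ) (ρ' : Literature.NumberTheory.GaloisRepresentations.FramedGaloisRep K (PadicAlgCl ℓ') n), ((ℓ' : ℕ) : NumberField.RingOfIntegers K) ∉ v.asIdeal → ρ'.toGaloisRep.IsIrreducible → (∀ᶠ w : IsDedekindDomain.HeightOneSpectrum (NumberField.RingOfIntegers K) in cofinite, SatakeFrobCompatibleAt ι' π.1 ρ' w) → LocalGlobalCompatibleAt Rec ι' π.1 ρ' v → LocalGlobalCompatibleAt Rec ι π.1 ρ v)) : ¬ _root_.Langlands :=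
  fun hL => h (stub_padicMemberCompatibility_of_langlands hL)

/-- **Stub L∤∀ (`stub_compatibilityAwayFromLAll`, the `∀ Rec` text of stmt-Langlands-17417) from the
summit**, by the same weak-to-strong upgrade. [cite: DeligneSerreASENS1974, Lemme 3.2] -/
theorem stub_compatibilityAwayFromLAll_of_langlands (h : _root_.Langlands) :
∀ (K : Type) [Field K] [NumberField K] (Rec : ReciprocityData K) (n : ℕ) (hcpt : Literature.NumberTheory.Automorphic.isCompact_glFiniteIntegralLevel n K), 0 < n → ∀ (π : Literature.NumberTheory.Automorphic.CuspidalAutomorphicRepData n K hcpt), π.1.IsLAlgebraic → ∀ (ℓ : ℕ) [Fact ℓ.Prime] (ι : PadicAlgCl ℓ ≃+* ℂ) (ρ : Literature.NumberTheory.GaloisRepresentations.FramedGaloisRep K (PadicAlgCl ℓ) n), ρ.toGaloisRep.IsIrreducible → ((∀ᶠ v : IsDedekindDomain.HeightOneSpectrum (NumberField.RingOfIntegers K) in cofinite, ρ.IsUnramifiedAt v) ∧ ∀ (v : IsDedekindDomain.HeightOneSpectrum (NumberField.RingOfIntegers K)) (hv : ((ℓ : ℕ) : NumberField.RingOfIntegers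 K) ∈ v.asIdeal), (Literature.NumberTheory.PAdicHodge.fontainePstAdicCompletion v ℓ hv).IsDeRhamFramed (ρ.toLocal v)) → (∀ᶠ v : IsDedekindDomain.HeightOneSpectrum (NumberField.RingOfIntegers K) in cofinite, SatakeFrobCompatibleAt ι π.1 ρ v) → ∀ v : IsDedekindDomain.HeightOneSpectrum (NumberField.RingOfIntegers K), ((ℓ : ℕ) : NumberField.RingOfIntegers K) ∉ v.asIdeal → LocalGlobalCompatibleAt Rec ι π.1 ρ v := by
  intro K _ _ Rec n hcpt hn π hL ℓ _ ι ρ hirr _ hρ v _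
  obtain ⟨-, hR⟩ := h K
  obtain ⟨ρ₁, -, -, hc₁, -⟩ := (hR Rec n hn hcpt).1 π hL ℓ ι
  exact (ReciprocityUpToIrreducibility.corresponds_of_exists_corresponds hirr hρ ⟨ρ₁, hc₁⟩).2 v

/-- … so a counterexample to L∤∀ refutes the summit. [folklore] -/
theorem not_langlands_of_not_stub_compatibilityAwayFromLAll (h : ¬ (
∀ (K : Type) [Field K] [NumberField K] (Rec : ReciprocityData K) (n : ℕ) (hcpt : Literature.NumberTheory.Automorphic.isCompact_glFiniteIntegralLevel n K), 0 < n → ∀ (π : Literature.NumberTheory.Automorphic.CuspidalAutomorphicRepData n K hcpt), π.1.IsLAlgebraic → ∀ (ℓ : ℕ) [Fact ℓ.Prime] (ι : PadicAlgCl ℓ ≃+* ℂ) (ρ : Literature.NumberTheory.GaloisRepresentations.FramedGaloisRep K (PadicAlgCl ℓ) n), ρ.toGaloisRep.IsIrreducible → ((∀ᶠ v : IsDedekindDomain.HeightOneSpectrum (NumberField.RingOfIntegers K) in cofinite, ρ.IsUnramifiedAt v) ∧ ∀ (v : IsDedekindDomain.HeightOneSpectrum (NumberField.RingOfIntegers K))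 (hv : ((ℓ : ℕ) : NumberField.RingOfIntegers K) ∈ v.asIdeal), (Literature.NumberTheory.PAdicHodge.fontainePstAdicCompletion v ℓ hv).IsDeRhamFramed (ρ.toLocal v)) → (∀ᶠ v : IsDedekindDomain.HeightOneSpectrum (NumberField.RingOfIntegers K) in cofinite, SatakeFrobCompatibleAt ι π.1 ρ v) → ∀ v : IsDedekindDomain.HeightOneSpectrum (NumberField.RingOfIntegers K), ((ℓ : ℕ) : NumberField.RingOfIntegers K) ∉ v.asIdeal → LocalGlobalCompatibleAt Rec ι π.1 ρ v)) : ¬ _root_.Langlands :=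
  fun hL => h (stub_compatibilityAwayFromLAll_of_langlands hL)

/-- **Stub B_w⁻ (`stub_weakAutomorphyOffSector`) from the summit**: direction (B) for any datum (its
hypothesis `IsGeometricFramed Rec ρ` is the pinned clause definitionally), sector data discarded.
[cite: FontaineMazurGeometric1995, Conj. 1] -/
theorem stub_weakAutomorphyOffSector_of_langlands (h : _root_.Langlands) :
∀ (K : Type) [Field K] [NumberField K] (n : ℕ) (hcpt : Literature.NumberTheory.Automorphic.isCompact_glFiniteIntegralLevel n K), 0 < n → ∀ (ℓ : ℕ) [Fact ℓ.Prime] (ι : PadicAlgCl ℓ ≃+* ℂ) (ρ : Literature.NumberTheory.GaloisRepresentations.FramedGaloisRep K (PadicAlgCl ℓ) n), ρ.toGaloisRep.IsIrreducible → ((∀ᶠ v : IsDedekindDomain.HeightOneSpectrum (NumberField.RingOfIntegers K) in cofinite, ρ.IsUnramifiedAt v) ∧ ∀ (v : IsDedekindDomain.HeightOneSpectrum (NumberField.RingOfIntegers K)) (hv : ((ℓ : ℕ) : NumberField.RingOfIntegers K) ∈ v.asIdeal), (Literature.NumberTheory.PAdicHodge.fontainePstAdicCompletion v ℓ hv).IsDeRhamFramed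 (ρ.toLocal v)) → ¬ (n = 2 ∧ Algebra.IsQuadraticExtension ℚ K ∧ NumberField.IsTotallyComplex K ∧ ∀ (v : IsDedekindDomain.HeightOneSpectrum (NumberField.RingOfIntegers K)) (hv : ((ℓ : ℕ) : NumberField.RingOfIntegers K) ∈ v.asIdeal), letI := (Literature.NumberTheory.PAdicHodge.fontainePstAdicCompletion v ℓ hv).algebra; ∀ τ : v.adicCompletion K →ₐ[ℚ_[ℓ]] PadicAlgCl ℓ, ∃ a b : ℤ, a < b ∧ ρ.labelledHodgeTateWeightsAt v (Literature.NumberTheory.PAdicHodge.fontainePstAdicCompletion v ℓ hv).algebra (Literature.NumberTheory.PAdicHodge.fontainePstAdicCompletion v ℓ hv).𝔅 τ.toRingHom = {a, b}) → ∃ π : Literature.NumberTheory.Automorphic.CuspidalAutomorphicRepData n K hcpt, π.1.IsLAlgebraic ∧ ∀ᶠ v : IsDedekindDomain.HeightOneSpectrum (NumberField.RingOfIntegers K) in cofinite, SatakeFrobCompatibleAt ι π.1 ρ v := by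
  intro K _ _ n hcpt hn ℓ _ ι ρ hirr hgeo _
  obtain ⟨⟨Rec⟩, hR⟩ := h K
  obtain ⟨π, hL, hcorr⟩ := (hR Rec n hn hcpt).2 ℓ ι ρ hirr hgeo
  exact ⟨π, hL, hcorr.1⟩

/-- … so a counterexample to B_w⁻ refutes the summit. [folklore] -/
theorem not_langlands_of_not_stub_weakAutomorphyOffSector (h : ¬ (
∀ (K : Type) [Field K] [NumberField K] (n : ℕ) (hcpt : Literature.NumberTheory.Automorphic.isCompact_glFiniteIntegralLevel n K), 0 < n → ∀ (ℓ : ℕ) [Fact ℓ.Prime] (ι : PadicAlgCl ℓ ≃+* ℂ) (ρ : Literature.NumberTheory.GaloisRepresentations.FramedGaloisRep K (PadicAlgCl ℓ) n), ρ.toGaloisRep.IsIrreducible → ((∀ᶠ v : IsDedekindDomain.HeightOneSpectrum (NumberField.RingOfIntegers K) in cofinite, ρ.IsUnramifiedAt v) ∧ ∀ (v : IsDedekindDomain.HeightOneSpectrum (NumberField.RingOfIntegers K)) (hv : ((ℓ : ℕ) : NumberField.RingOfIntegers K) ∈ v.asIdeal), (Literature.NumberTheory.PAdicHodge.fontainePstAdicCompletion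 v ℓ hv).IsDeRhamFramed (ρ.toLocal v)) → ¬ (n = 2 ∧ Algebra.IsQuadraticExtension ℚ K ∧ NumberField.IsTotallyComplex K ∧ ∀ (v : IsDedekindDomain.HeightOneSpectrum (NumberField.RingOfIntegers K)) (hv : ((ℓ : ℕ) : NumberField.RingOfIntegers K) ∈ v.asIdeal), letI := (Literature.NumberTheory.PAdicHodge.fontainePstAdicCompletion v ℓ hv).algebra; ∀ τ : v.adicCompletion K →ₐ[ℚ_[ℓ]] PadicAlgCl ℓ, ∃ a b : ℤ, a < b ∧ ρ.labelledHodgeTateWeightsAt v (Literature.NumberTheory.PAdicHodge.fontainePstAdicCompletion v ℓ hv).algebra (Literature.NumberTheory.PAdicHodge.fontainePstAdicCompletion v ℓ hv).𝔅 τ.toRingHom = {a, b}) → ∃ π : Literature.NumberTheory.Automorphic.CuspidalAutomorphicRepData n K hcpt, π.1.IsLAlgebraic ∧ ∀ᶠ v : IsDedekindDomain.HeightOneSpectrum (NumberField.RingOfIntegers K) in cofinite, SatakeFrobCompatibleAt ι π.1 ρ v)) : ¬ _root_.Langlands :=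
  fun hL => h (stub_weakAutomorphyOffSector_of_langlands hL)

/-- **Stub B_w⁺ (`stub_weakParallelModularity`, the `Target`-fed stub) from the summit**: direction
(B) at `n = 2`; regularity and parallelism discarded. [cite: FontaineMazurGeometric1995, Conj. 1]
[cite: CalegariMazur2008, Conj. 1.3] -/
theorem stub_weakParallelModularity_of_langlands (h : _root_.Langlands) :
∀ (F : Type) [Field F] [NumberField F] [Algebra.IsQuadraticExtension ℚ F], NumberField.IsTotallyComplex F → ∀ (hcpt : Literature.NumberTheory.Automorphic.isCompact_glFiniteIntegralLevel 2 F) (ℓ : ℕ) [Fact ℓ.Prime] (ι : PadicAlgCl ℓ ≃+* ℂ) (ρ : Literature.NumberTheory.GaloisRepresentations.FramedGaloisRep F (PadicAlgCl ℓ) 2), ρ.toGaloisRep.IsIrreducible → ((∀ᶠ v : IsDedekindDomain.HeightOneSpectrum (NumberField.RingOfIntegers F) in cofinite, ρ.IsUnramifiedAt v) ∧ ∀ (v : IsDedekindDomain.HeightOneSpectrum (NumberField.RingOfIntegers F)) (hv : ((ℓ : ℕ) : NumberField.RingOfIntegers F) ∈ v.asIdeal), (Literature.NumberTheory.PAdicHodge.fontainePstAdicCompletion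 v ℓ hv).IsDeRhamFramed (ρ.toLocal v)) → (∀ (v : IsDedekindDomain.HeightOneSpectrum (NumberField.RingOfIntegers F)) (hv : ((ℓ : ℕ) : NumberField.RingOfIntegers F) ∈ v.asIdeal), letI := (Literature.NumberTheory.PAdicHodge.fontainePstAdicCompletion v ℓ hv).algebra; ∀ τ : v.adicCompletion F →ₐ[ℚ_[ℓ]] PadicAlgCl ℓ, ∃ a b : ℤ, a < b ∧ ρ.labelledHodgeTateWeightsAt v (Literature.NumberTheory.PAdicHodge.fontainePstAdicCompletion v ℓ hv).algebra (Literature.NumberTheory.PAdicHodge.fontainePstAdicCompletion v ℓ hv).𝔅 τ.toRingHom = {a, b}) → (∃ g : ℤ, ∀ (v : IsDedekindDomain.HeightOneSpectrum (NumberField.RingOfIntegers F)) (hv : ((ℓ : ℕ) : NumberField.RingOfIntegers F) ∈ v.asIdeal), letI := (Literature.NumberTheory.PAdicHodge.fontainePstAdicCompletion v ℓ hv).algebra; ∀ τ : v.adicCompletion F →ₐ[ℚ_[ℓ]] PadicAlgCl ℓ, ∃ a : ℤ, ρ.labelledHodgeTateWeightsAt v (Literature.NumberTheory.PAdicHodge.fontainePstAdicCompletion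 v ℓ hv).algebra (Literature.NumberTheory.PAdicHodge.fontainePstAdicCompletion v ℓ hv).𝔅 τ.toRingHom = {a, a + g}) → ∃ π : Literature.NumberTheory.Automorphic.CuspidalAutomorphicRepData 2 F hcpt, π.1.IsLAlgebraic ∧ ∀ᶠ v : IsDedekindDomain.HeightOneSpectrum (NumberField.RingOfIntegers F) in cofinite, SatakeFrobCompatibleAt ι π.1 ρ v := by
  intro F _ _ _ _ hcpt ℓ _ ι ρ hirr hgeo _ _
  obtain ⟨⟨Rec⟩, hR⟩ := h F
  obtain ⟨π, hL, hcorr⟩ := (hR Rec 2 two_pos hcpt).2 ℓ ι ρ hirr hgeo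
  exact ⟨π, hL, hcorr.1⟩

/-- … so a counterexample to B_w⁺ refutes the summit. [folklore] -/
theorem not_langlands_of_not_stub_weakParallelModularity (h : ¬ (
∀ (F : Type) [Field F] [NumberField F] [Algebra.IsQuadraticExtension ℚ F], NumberField.IsTotallyComplex F → ∀ (hcpt : Literature.NumberTheory.Automorphic.isCompact_glFiniteIntegralLevel 2 F) (ℓ : ℕ) [Fact ℓ.Prime] (ι : PadicAlgCl ℓ ≃+* ℂ) (ρ : Literature.NumberTheory.GaloisRepresentations.FramedGaloisRep F (PadicAlgCl ℓ) 2), ρ.toGaloisRep.IsIrreducible → ((∀ᶠ v : IsDedekindDomain.HeightOneSpectrum (NumberField.RingOfIntegers F) in cofinite, ρ.IsUnramifiedAt v) ∧ ∀ (v : IsDedekindDomain.HeightOneSpectrum (NumberField.RingOfIntegers F)) (hv : ((ℓ : ℕ) : NumberField.RingOfIntegers F) ∈ v.asIdeal), (Literature.NumberTheory.PAdicHodge.fontainePstAdicCompletion v ℓ hv).IsDeRhamFramed (ρ.toLocal v)) → (∀ (v : IsDedekindDomain.HeightOneSpectrum (NumberField.RingOfIntegers F)) (hv : ((ℓ : ℕ)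 : NumberField.RingOfIntegers F) ∈ v.asIdeal), letI := (Literature.NumberTheory.PAdicHodge.fontainePstAdicCompletion v ℓ hv).algebra; ∀ τ : v.adicCompletion F →ₐ[ℚ_[ℓ]] PadicAlgCl ℓ, ∃ a b : ℤ, a < b ∧ ρ.labelledHodgeTateWeightsAt v (Literature.NumberTheory.PAdicHodge.fontainePstAdicCompletion v ℓ hv).algebra (Literature.NumberTheory.PAdicHodge.fontainePstAdicCompletion v ℓ hv).𝔅 τ.toRingHom = {a, b}) → (∃ g : ℤ, ∀ (v : IsDedekindDomain.HeightOneSpectrum (NumberField.RingOfIntegers F)) (hv : ((ℓ : ℕ) : NumberField.RingOfIntegers F) ∈ v.asIdeal), letI := (Literature.NumberTheory.PAdicHodge.fontainePstAdicCompletion v ℓ hv).algebra; ∀ τ : v.adicCompletion F →ₐ[ℚ_[ℓ]] PadicAlgCl ℓ, ∃ a : ℤ, ρ.labelledHodgeTateWeightsAt v (Literature.NumberTheory.PAdicHodge.fontainePstAdicCompletion v ℓ hv).algebra (Literature.NumberTheory.PAdicHodge.fontainePstAdicCompletion v ℓ hv).𝔅 τ.toRingHom = {a, a + g}) → ∃ π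 : Literature.NumberTheory.Automorphic.CuspidalAutomorphicRepData 2 F hcpt, π.1.IsLAlgebraic ∧ ∀ᶠ v : IsDedekindDomain.HeightOneSpectrum (NumberField.RingOfIntegers F) in cofinite, SatakeFrobCompatibleAt ι π.1 ρ v)) : ¬ _root_.Langlands :=
  fun hL => h (stub_weakParallelModularity_of_langlands hL)

end Summit.Langlands.Langlands.Theorems.VoidToLanglands.Negative

end
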